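import Literature.AlgebraicGeometry.Motives.HodgeLieProductSimpleFactor
import Literature.AlgebraicGeometry.Motives.HodgeLieSemisimpleTimesAbelian
import Literature.AlgebraicGeometry.Motives.HodgeLieReductiveAnyWeight
import HarnessLib

/-!
# `Θ`-rigidity along a summand with one-dimensional Hodge Lie algebra: `H₁` rigid, `𝔥(H₂) = ℚ y₀`, `ι₂ y₀ π₂ ∈ 𝔥(H₁ ⊕ H₂)` ⟹ every
# bracket-closed rational `𝔞 ⊆ 𝔥(H₁ ⊕ H₂)` containing a Hodge operator after complexification is ALL of `𝔥`, OR the GRAPH of a Lie functional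
# (Moonen–Zarhin 1999 §3 (3.1): the projections `Hg(X₁ × X₂) → Hg(X_i)` are onto; Goursat over a one-dimensional factor)

Family `hodge`, layer `Literature/AlgebraicGeometry/Motives`; THEOREMS ONLY (no definition, no named fact).  Written for the cell `pub-hodgecm2`
(COR-CM), seat `b27` gen 49 (count-neutral Mumford–Tate-rank ladder).  Sequel of `Motives/HodgeLieProductSimpleFactor` (the restriction
`r₁ : 𝔥(H) → 𝔥(H₁)`, `X ↦ π₁ X ι₁`, is a Lie homomorphism and is ONTO when `H₁` is `Θ`-rigid).

SETTING.  `H ≅ H₁ ⊕ H₂` (`ι_i`, `π_i`, `π_i ι_i = id`, `ι₁π₁ + ι₂π₂ = id`), `H₁` `Θ`-RIGID (every bracket-closed rational `𝔞₁ ⊆ 𝔥(H₁)` whose complex span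
contains a Hodge operator of `H₁` contains `𝔥(H₁)`), `𝔥(H₂) ⊆ ℚ y₀` (e.g. `H₂ = H¹` of a CM elliptic curve), and the corner `ι₂ y₀ π₂ ∈ 𝔥(H)`
(`𝔥(H) = 𝔥(H₁) × ℚ y₀`).  QUESTION: is `H` `Θ`-rigid?  Let `𝔞 ⊆ 𝔥(H)` be bracket-closed with a Hodge operator `Θ ∈ 𝔞 ⊗ ℂ`.  Then `r₁(𝔞) ⊆ 𝔥(H₁)` is
bracket-closed and its complex span contains the Hodge operator `π₁ Θ ι₁` of `H₁`, so `r₁(𝔞) = 𝔥(H₁)` by rigidity.  EITHER the corner lies in `𝔞` —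
then `𝔥(H) ⊆ 𝔞` (`z − a = ι₂ r₂(z − a) π₂ ∈ ℚ·corner` for `r₁ a = r₁ z`); OR `r₁|_𝔞` is injective and `𝔞` is the GRAPH
`{ι₁ x π₁ + L(x)·ι₂ y₀ π₂ : x ∈ 𝔥(H₁)}` of a linear functional `L` on `𝔥(H₁)` KILLING ALL COMMUTATORS (`r₂` of a bracket of `𝔞` is a bracket of
multiples of `y₀`).  The second alternative is a RESONANCE which the user refutes from `Θ ∈ 𝔞 ⊗ ℂ` (e.g. by a trace functional: `L` factors
through `𝔥(H₁)/[𝔥(H₁), 𝔥(H₁)] = 𝔷(H₁)`); when it is refuted for every `L`, `H` is `Θ`-rigid and the monotonicity `dim 𝔥(H ⊕ H') ≥ dim 𝔥(H)` of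
`CorCM/MumfordTateRankRigidMonotone` applies to `H = H₁ ⊕ H₂`.

* **`hodgeLie_le_or_exists_graph_of_rigid_of_le_span_singleton`** — the dichotomy above;
* `rigid_of_rigid_of_le_span_singleton_of_forall_not_graph` — `H` is `Θ`-rigid as soon as no such graph contains a Hodge operator in its complex span;
* **`rigid_of_rigid_of_le_span_singleton_of_trace_ne`** — the TRACE TEST: if the centre `𝔥(H₁) ∩ End_Hdg(H₁)` lies on a line `ℚφ` (`φ ∈ End_Hdg(H₁)`)
  and `tr(Θ₂ y₀)·tr(φ²) ≠ μ·tr(y₀²)·tr(Θ₁ φ)` for every rational `μ` (Hodge operators `Θ_i` of `H_i`), then `H` is `Θ`-rigid — a Lie functional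
  factors through `𝔥(H₁)/[𝔥(H₁),𝔥(H₁)] ≅ 𝔷(H₁) ⊆ ℚφ` (Deligne: `𝔥 = 𝔷 ⊕ [𝔥,𝔥]`), so on the graph `tr(r₂(·) y₀) tr(φ²) = L(φ) tr(y₀²) tr(r₁(·) φ)`.

## References
* [MoonenZarhin1999LowDim] B. Moonen, Yu. G. Zarhin, *Hodge classes on abelian varieties of low dimension*, Math. Ann. 315 (1999), §3 (3.1), Lemma (3.6)
  [corpus: paper:arxiv-math_9901113 p. 6]. [cite: MoonenZarhin1999LowDim, §3 (3.1) and (3.6)]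
* [Hazama1983] F. Hazama, *Algebraic cycles on abelian varieties with many real endomorphisms*, Tôhoku Math. J. 35 (1983), Lemma (3.1) (Goursat).
  [cite: Hazama1983, Lemma (3.1)]
* [Deligne1982HodgeCycles] P. Deligne, LNM 900 (1982), I §3.1 and Prop. 3.4. [cite: Deligne1982HodgeCycles, I §3.1 and Prop. 3.4]
-/

noncomputable section

open scoped TensorProduct

namespace Literature.AlgebraicGeometry.Motives

namespace HodgeStructure

universe u

variable {V₁ : Type u} [AddCommGroup V₁] [Module ℚ V₁] [Module.Finite ℚ V₁]
  {V₂ : Type u} [AddCommGroup V₂] [Module ℚ V₂] [Module.Finite ℚ V₂]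
  {V : Type u} [AddCommGroup V] [Module ℚ V] [Module.Finite ℚ V] [HodgeTensorFacts.{u, u}] {n : ℤ}
  {H₁ : HodgeStructure V₁ n} {H₂ : HodgeStructure V₂ n} {H : HodgeStructure V n}
  (ι₁ : Hom H₁ H) (π₁ : Hom H H₁) (ι₂ : Hom H₂ H) (π₂ : Hom H H₂)
  (hπι₁ : ∀ v, π₁.toLinearMap (ι₁.toLinearMap v) = v) (hπι₂ : ∀ v, π₂.toLinearMap (ι₂.toLinearMap v) = v)
  (hsum : ∀ v, ι₁.toLinearMap (π₁.toLinearMap v) + ι₂.toLinearMap (π₂.toLinearMap v) = v)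
  (hrig₁ : ∀ 𝔞 : Submodule ℚ (Module.End ℚ V₁), 𝔞 ≤ H₁.hodgeLie →
      (∀ X ∈ 𝔞, ∀ Y ∈ 𝔞, X * Y - Y * X ∈ 𝔞) →
      (∃ Θ ∈ Submodule.span ℂ ((fun X : Module.End ℚ V₁ => X.baseChange ℂ) '' (𝔞 : Set (Module.End ℚ V₁))),
        ∀ p, ∀ x ∈ H₁.piece p (n - p), Θ x = ((2 * p - n : ℤ) : ℂ) • x) → H₁.hodgeLie ≤ 𝔞)
  {y₀ : Module.End ℚ V₂} (hy₀ : H₂.hodgeLie ≤ ℚ ∙ y₀)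
  (hcorner : ι₂.toLinearMap ∘ₗ y₀ ∘ₗ π₂.toLinearMap ∈ H.hodgeLie)

/-! ## §1 The image `r₁(𝔞)` of a bracket-closed `𝔞 ∋_ℂ Θ` is `𝔥(H₁)` -/

omit [Module.Finite ℚ V₁] [Module.Finite ℚ V] [HodgeTensorFacts.{u, u}] in
include hπι₁ in
/-- **`π₁ Θ ι₁` is a Hodge operator of `H₁` lying in the complex span of `r₁(𝔞)`**, for `Θ` a Hodge operator of `H` in the complex span of `𝔞`
(morphisms map `V₁^{p,q}` into `V^{p,q}`; `π₁ ι₁ = id`). [cite: Deligne1982HodgeCycles, I §3.1 and Prop. 3.4] -/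
theorem exists_theta_mem_span_restrict_of_mem_span (𝔞 : Submodule ℚ (Module.End ℚ V))
    (hΘ : ∃ Θ ∈ Submodule.span ℂ ((fun X : Module.End ℚ V => X.baseChange ℂ) '' (𝔞 : Set (Module.End ℚ V))),
      ∀ p, ∀ x ∈ H.piece p (n - p), Θ x = ((2 * p - n : ℤ) : ℂ) • x) :
    ∃ Θ₁ ∈ Submodule.span ℂ ((fun X : Module.End ℚ V₁ => X.baseChange ℂ) ''
        ((𝔞.map ((LinearMap.llcomp ℚ V₁ V V₁ π₁.toLinearMap).comp (LinearMap.lcomp ℚ V ι₁.toLinearMap)) :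
          Submodule ℚ (Module.End ℚ V₁)) : Set (Module.End ℚ V₁))),
      ∀ p, ∀ x ∈ H₁.piece p (n - p), Θ₁ x = ((2 * p - n : ℤ) : ℂ) • x := by
  obtain ⟨Θ, hΘmem, hΘ⟩ := hΘ
  have hπιc : π₁.toLinearMap ∘ₗ ι₁.toLinearMap = LinearMap.id := LinearMap.ext hπι₁
  set r := (LinearMap.llcomp ℚ V₁ V V₁ π₁.toLinearMap).comp (LinearMap.lcomp ℚ V ι₁.toLinearMap) with hr
  have hr_apply : ∀ X : Module.End ℚ V, r X = π₁.toLinearMap ∘ₗ X ∘ₗ ι₁.toLinearMap := fun X => rfl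
  have hmap : ∀ Z ∈ Submodule.span ℂ ((fun X : Module.End ℚ V => X.baseChange ℂ) '' (𝔞 : Set (Module.End ℚ V))),
      π₁.toLinearMap.baseChange ℂ ∘ₗ Z ∘ₗ ι₁.toLinearMap.baseChange ℂ ∈
        Submodule.span ℂ ((fun X : Module.End ℚ V₁ => X.baseChange ℂ) '' ((𝔞.map r : Submodule ℚ (Module.End ℚ V₁)) : Set (Module.End ℚ V₁))) := by
    intro Z hZ
    induction hZ using Submodule.span_induction with
    | mem Z hZ =>
      obtain ⟨X, hX, rfl⟩ := hZ
      refine Submodule.subset_span ⟨π₁.toLinearMap ∘ₗ X ∘ₗ ι₁.toLinearMap, ⟨X, hX, rfl⟩, ?_⟩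
      simp only [LinearMap.baseChange_comp]
    | zero =>
      rw [LinearMap.zero_comp, LinearMap.comp_zero]
      exact Submodule.zero_mem _
    | add Z Z' _ _ hZ hZ' =>
      rw [LinearMap.add_comp, LinearMap.comp_add]
      exact Submodule.add_mem _ hZ hZ'
    | smul c Z _ hZ =>
      rw [LinearMap.smul_comp, LinearMap.comp_smul]
      exact Submodule.smul_mem _ c hZ
  refine ⟨π₁.toLinearMap.baseChange ℂ ∘ₗ Θ ∘ₗ ι₁.toLinearMap.baseChange ℂ, hmap Θ hΘmem, ?_⟩
  intro p x hx
  have hιx : ι₁.toLinearMap.baseChange ℂ x ∈ H.piece p (n - p) := ι₁.map_piece_le p (n - p) ⟨x, hx, rfl⟩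
  rw [LinearMap.comp_apply, LinearMap.comp_apply, hΘ p _ hιx, map_smul, ← LinearMap.comp_apply,
    ← LinearMap.baseChange_comp, hπιc, LinearMap.baseChange_id, LinearMap.id_apply]

include hπι₁ hrig₁ in
/-- **`r₁(𝔞) = 𝔥(H₁)` for every bracket-closed rational `𝔞 ⊆ 𝔥(H)` whose complex span contains a Hodge operator**, `H₁` `Θ`-rigid
(`r₁(𝔞) ⊆ 𝔥(H₁)` by `comp_mem_hodgeLie_of_retract`, bracket-closed by `restrict_mul`, and §1). [cite: MoonenZarhin1999LowDim, §3 (3.1)] -/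
theorem map_restrict_eq_hodgeLie_of_rigid (𝔞 : Submodule ℚ (Module.End ℚ V)) (h𝔞 : 𝔞 ≤ H.hodgeLie)
    (hbr : ∀ A ∈ 𝔞, ∀ B ∈ 𝔞, A * B - B * A ∈ 𝔞)
    (hΘ : ∃ Θ ∈ Submodule.span ℂ ((fun X : Module.End ℚ V => X.baseChange ℂ) '' (𝔞 : Set (Module.End ℚ V))),
      ∀ p, ∀ x ∈ H.piece p (n - p), Θ x = ((2 * p - n : ℤ) : ℂ) • x) :
    𝔞.map ((LinearMap.llcomp ℚ V₁ V V₁ π₁.toLinearMap).comp (LinearMap.lcomp ℚ V ι₁.toLinearMap)) = H₁.hodgeLie := by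
  set r := (LinearMap.llcomp ℚ V₁ V V₁ π₁.toLinearMap).comp (LinearMap.lcomp ℚ V ι₁.toLinearMap) with hr
  have hr_apply : ∀ X : Module.End ℚ V, r X = π₁.toLinearMap ∘ₗ X ∘ₗ ι₁.toLinearMap := fun X => rfl
  have hle : 𝔞.map r ≤ H₁.hodgeLie := by
    rintro _ ⟨X, hX, rfl⟩
    rw [hr_apply]
    exact comp_mem_hodgeLie_of_retract ι₁ π₁ hπι₁ (h𝔞 hX)
  refine le_antisymm hle (hrig₁ _ hle ?_ (exists_theta_mem_span_restrict_of_mem_span ι₁ π₁ hπι₁ 𝔞 hΘ))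
  rintro _ ⟨X, hX, rfl⟩ _ ⟨Y, hY, rfl⟩
  refine ⟨X * Y - Y * X, hbr X hX Y hY, ?_⟩
  rw [hr_apply, hr_apply, hr_apply, ← restrict_mul ι₁ π₁ hπι₁ (h𝔞 hY), ← restrict_mul ι₁ π₁ hπι₁ (h𝔞 hX)]
  refine LinearMap.ext fun v => ?_
  simp only [LinearMap.comp_apply, LinearMap.sub_apply, Module.End.mul_apply, map_sub]

/-! ## §2 The dichotomy: all of `𝔥(H)`, or the graph of a Lie functional -/

include hπι₁ hπι₂ hsum hrig₁ hy₀ hcorner in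
/-- **`Θ`-rigidity along a summand with `𝔥(H₂) ⊆ ℚ y₀` — the dichotomy.**  `H ≅ H₁ ⊕ H₂`, `H₁` `Θ`-rigid, `𝔥(H₂) ⊆ ℚ y₀`, `ι₂ y₀ π₂ ∈ 𝔥(H)`.
For every bracket-closed rational `𝔞 ⊆ 𝔥(H)` whose complex span contains a Hodge operator of `H`: EITHER `𝔥(H) ⊆ 𝔞`, OR there is a `ℚ`-linear
functional `L` on `End V₁` VANISHING ON ALL COMMUTATORS of `𝔥(H₁)` such that every `a ∈ 𝔞` is `ι₁ (π₁ a ι₁) π₁ + L(π₁ a ι₁)·ι₂ y₀ π₂` (the graph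
of `L` over `𝔥(H₁) = r₁(𝔞)`). [cite: MoonenZarhin1999LowDim, §3 (3.1) and (3.6)] [cite: Hazama1983, Lemma (3.1)] -/
theorem hodgeLie_le_or_exists_graph_of_rigid_of_le_span_singleton (𝔞 : Submodule ℚ (Module.End ℚ V)) (h𝔞 : 𝔞 ≤ H.hodgeLie)
    (hbr : ∀ A ∈ 𝔞, ∀ B ∈ 𝔞, A * B - B * A ∈ 𝔞)
    (hΘ : ∃ Θ ∈ Submodule.span ℂ ((fun X : Module.End ℚ V => X.baseChange ℂ) '' (𝔞 : Set (Module.End ℚ V))),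
      ∀ p, ∀ x ∈ H.piece p (n - p), Θ x = ((2 * p - n : ℤ) : ℂ) • x) :
    H.hodgeLie ≤ 𝔞 ∨
      ∃ L : Module.End ℚ V₁ →ₗ[ℚ] ℚ,
        (∀ A ∈ H₁.hodgeLie, ∀ B ∈ H₁.hodgeLie, L (A * B - B * A) = 0) ∧
        ∀ a ∈ 𝔞, a = ι₁.toLinearMap ∘ₗ (π₁.toLinearMap ∘ₗ a ∘ₗ ι₁.toLinearMap) ∘ₗ π₁.toLinearMap +
          L (π₁.toLinearMap ∘ₗ a ∘ₗ ι₁.toLinearMap) • (ι₂.toLinearMap ∘ₗ y₀ ∘ₗ π₂.toLinearMap) := by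
  classical
  set r := (LinearMap.llcomp ℚ V₁ V V₁ π₁.toLinearMap).comp (LinearMap.lcomp ℚ V ι₁.toLinearMap) with hr
  have hr_apply : ∀ X : Module.End ℚ V, r X = π₁.toLinearMap ∘ₗ X ∘ₗ ι₁.toLinearMap := fun X => rfl
  set c₀ := ι₂.toLinearMap ∘ₗ y₀ ∘ₗ π₂.toLinearMap with hc₀
  have himg := map_restrict_eq_hodgeLie_of_rigid ι₁ π₁ hπι₁ hrig₁ 𝔞 h𝔞 hbr hΘ
  -- the second block of an element of `𝔥(H)` is a multiple of `y₀`; zero first block ⟹ a multiple of the corner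
  have hr₂ : ∀ z ∈ H.hodgeLie, ∃ q : ℚ, π₂.toLinearMap ∘ₗ z ∘ₗ ι₂.toLinearMap = q • y₀ := fun z hz =>
    Submodule.mem_span_singleton.1 (hy₀ (comp_mem_hodgeLie_of_retract ι₂ π₂ hπι₂ hz)) |>.imp fun q hq => hq.symm
  have hker : ∀ z ∈ H.hodgeLie, π₁.toLinearMap ∘ₗ z ∘ₗ ι₁.toLinearMap = 0 → ∃ q : ℚ, z = q • c₀ := by
    intro z hz hz0
    obtain ⟨q, hq⟩ := hr₂ z hz
    refine ⟨q, ?_⟩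
    have h := eq_sum_blocks_of_mem_hodgeLie ι₁ π₁ ι₂ π₂ hπι₁ hπι₂ hsum hz
    rw [hz0, LinearMap.zero_comp, LinearMap.comp_zero, zero_add, hq, LinearMap.smul_comp, LinearMap.comp_smul] at h
    exact h
  by_cases hc : c₀ ∈ 𝔞
  · -- the corner lies in `𝔞`: `𝔥(H) ⊆ 𝔞`
    left
    intro z hz
    have hz₁ : r z ∈ 𝔞.map r := by
      rw [himg, hr_apply]
      exact comp_mem_hodgeLie_of_retract ι₁ π₁ hπι₁ hz
    obtain ⟨a, ha, haz⟩ := hz₁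
    obtain ⟨q, hq⟩ := hker (z - a) (Submodule.sub_mem _ hz (h𝔞 ha)) (by
      rw [hr_apply, hr_apply] at haz
      rw [LinearMap.sub_comp, LinearMap.comp_sub, haz, sub_self])
    have : z = a + q • c₀ := by rw [← hq]; abel
    rw [this]
    exact Submodule.add_mem _ ha (Submodule.smul_mem _ q hc)
  · -- the corner is not in `𝔞`: `r₁|_𝔞` is injective and `𝔞` is a graph
    right
    have hy₀0 : y₀ ≠ 0 := by
      rintro rfl
      apply hc
      rw [hc₀, LinearMap.zero_comp, LinearMap.comp_zero]
      exact Submodule.zero_mem _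
    have hinj : ∀ a ∈ 𝔞, r a = 0 → a = 0 := by
      intro a ha ha0
      obtain ⟨q, hq⟩ := hker a (h𝔞 ha) (by rw [← hr_apply]; exact ha0)
      by_cases hq0 : q = 0
      · rw [hq, hq0, zero_smul]
      · exfalso
        apply hc
        have : c₀ = q⁻¹ • a := by rw [hq, smul_smul, inv_mul_cancel₀ hq0, one_smul]
        rw [this]
        exact Submodule.smul_mem _ _ ha
    -- `e : 𝔞 ≃ 𝔥(H₁)` along `r`
    have hrange : ∀ a : 𝔞, r a ∈ H₁.hodgeLie := fun a => by
      rw [← himg]; exact Submodule.mem_map_of_mem a.2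
    let e₀ : 𝔞 →ₗ[ℚ] H₁.hodgeLie := LinearMap.codRestrict _ (r.domRestrict 𝔞) hrange
    have he₀ : ∀ a : 𝔞, ((e₀ a : H₁.hodgeLie) : Module.End ℚ V₁) = r a := fun a => rfl
    have he₀inj : Function.Injective e₀ := by
      intro a b hab
      apply Subtype.ext
      have h : r (a : Module.End ℚ V) = r b := by
        have := congrArg (fun x : H₁.hodgeLie => (x : Module.End ℚ V₁)) hab
        simpa [he₀] using this
      have h0 : (a : Module.End ℚ V) - b = 0 :=
        hinj _ (Submodule.sub_mem _ a.2 b.2) (by rw [map_sub, h, sub_self])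
      exact sub_eq_zero.1 h0
    have he₀surj : Function.Surjective e₀ := by
      rintro ⟨x, hx⟩
      rw [← himg] at hx
      obtain ⟨a, ha, rfl⟩ := hx
      exact ⟨⟨a, ha⟩, Subtype.ext rfl⟩
    let e : 𝔞 ≃ₗ[ℚ] H₁.hodgeLie := LinearEquiv.ofBijective e₀ ⟨he₀inj, he₀surj⟩
    have he : ∀ a : 𝔞, ((e a : H₁.hodgeLie) : Module.End ℚ V₁) = r a := fun a => rfl
    -- the coefficient of the second block along `y₀`
    let s₂ := (LinearMap.llcomp ℚ V₂ V V₂ π₂.toLinearMap).comp (LinearMap.lcomp ℚ V ι₂.toLinearMap)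
    have hs₂_apply : ∀ X : Module.End ℚ V, s₂ X = π₂.toLinearMap ∘ₗ X ∘ₗ ι₂.toLinearMap := fun X => rfl
    have hs₂mem : ∀ a : 𝔞, s₂ a ∈ ℚ ∙ y₀ := fun a => by
      rw [hs₂_apply]; exact hy₀ (comp_mem_hodgeLie_of_retract ι₂ π₂ hπι₂ (h𝔞 a.2))
    let coef : 𝔞 →ₗ[ℚ] ℚ :=
      (LinearEquiv.toSpanNonzeroSingleton ℚ (Module.End ℚ V₂) y₀ hy₀0).symm.toLinearMap ∘ₗ
        LinearMap.codRestrict _ (s₂.domRestrict 𝔞) hs₂mem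
    have hcoef : ∀ a : 𝔞, coef a • y₀ = π₂.toLinearMap ∘ₗ (a : Module.End ℚ V) ∘ₗ ι₂.toLinearMap := fun a =>
      LinearEquiv.toSpanNonzeroSingleton_symm_apply_smul ℚ (Module.End ℚ V₂) y₀ hy₀0 ⟨_, hs₂mem a⟩
    -- the functional `L`: extend `coef ∘ e⁻¹` from `𝔥(H₁)` to `End V₁`
    obtain ⟨L, hL⟩ := LinearMap.exists_extend (coef ∘ₗ e.symm.toLinearMap : H₁.hodgeLie →ₗ[ℚ] ℚ)
    have hLr : ∀ a : 𝔞, L (r a) = coef a := fun a => by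
      have h := LinearMap.congr_fun hL (e a)
      simp only [LinearMap.comp_apply, Submodule.subtype_apply, LinearEquiv.coe_toLinearMap, LinearEquiv.symm_apply_apply] at h
      rw [← he a]
      exact h
    refine ⟨L, ?_, ?_⟩
    · -- `L` kills commutators of `𝔥(H₁)`
      intro A hA B hB
      set a := e.symm ⟨A, hA⟩ with ha
      set b := e.symm ⟨B, hB⟩ with hb
      have hra : r a = A := by rw [← he a, ha, LinearEquiv.apply_symm_apply]
      have hrb : r b = B := by rw [← he b, hb, LinearEquiv.apply_symm_apply]
      have hab : (a : Module.End ℚ V) * (b : Module.End ℚ V) - (b : Module.End ℚ V) * (a : Module.End ℚ V) ∈ 𝔞 := hbr _ a.2 _ b.2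
      have hrab : r ((a : Module.End ℚ V) * (b : Module.End ℚ V) - (b : Module.End ℚ V) * (a : Module.End ℚ V)) = A * B - B * A := by
        rw [map_sub, hr_apply, hr_apply, restrict_mul ι₁ π₁ hπι₁ (h𝔞 b.2), restrict_mul ι₁ π₁ hπι₁ (h𝔞 a.2), ← hr_apply,
          ← hr_apply, hra, hrb]
      rw [← hrab, hLr ⟨_, hab⟩]
      -- the second block of the commutator vanishes: both blocks are multiples of `y₀`
      have h2 : coef ⟨_, hab⟩ • y₀ = 0 := by
        rw [hcoef ⟨_, hab⟩]
        change π₂.toLinearMap ∘ₗ ((a : Module.End ℚ V) * (b : Module.End ℚ V) - (b : Module.End ℚ V) * (a : Module.End ℚ V)) ∘ₗ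
          ι₂.toLinearMap = 0
        rw [LinearMap.sub_comp, LinearMap.comp_sub, restrict_mul ι₂ π₂ hπι₂ (h𝔞 b.2), restrict_mul ι₂ π₂ hπι₂ (h𝔞 a.2),
          ← hcoef a, ← hcoef b]
        rw [smul_mul_smul_comm, smul_mul_smul_comm, mul_comm (coef b) (coef a), sub_self]
      exact (smul_eq_zero.1 h2).resolve_right hy₀0
    · -- every `a ∈ 𝔞` is on the graph
      intro a ha
      have h := eq_sum_blocks_of_mem_hodgeLie ι₁ π₁ ι₂ π₂ hπι₁ hπι₂ hsum (h𝔞 ha)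
      have h2 : π₂.toLinearMap ∘ₗ a ∘ₗ ι₂.toLinearMap = L (π₁.toLinearMap ∘ₗ a ∘ₗ ι₁.toLinearMap) • y₀ := by
        rw [← hr_apply, hLr ⟨a, ha⟩, hcoef ⟨a, ha⟩]
      rw [h2, LinearMap.smul_comp, LinearMap.comp_smul] at h
      exact h

include hπι₁ hπι₂ hsum hrig₁ hy₀ hcorner in
/-- **`H` is `Θ`-rigid when no graph resonates**: if for every `ℚ`-linear functional `L` on `End V₁` killing the commutators of `𝔥(H₁)` the complex
span of the graph `{ι₁ x π₁ + L(x)·ι₂ y₀ π₂ : x ∈ 𝔥(H₁)}` contains NO Hodge operator of `H`, then every bracket-closed rational `𝔞 ⊆ 𝔥(H)` whose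
complex span contains a Hodge operator contains `𝔥(H)`. [cite: MoonenZarhin1999LowDim, §3 (3.1) and (3.6)] -/
theorem rigid_of_rigid_of_le_span_singleton_of_forall_not_graph
    (hNR : ∀ L : Module.End ℚ V₁ →ₗ[ℚ] ℚ, (∀ A ∈ H₁.hodgeLie, ∀ B ∈ H₁.hodgeLie, L (A * B - B * A) = 0) →
      ¬ ∃ Θ ∈ Submodule.span ℂ ((fun X : Module.End ℚ V => X.baseChange ℂ) ''
          {Z | ∃ x ∈ H₁.hodgeLie, Z = ι₁.toLinearMap ∘ₗ x ∘ₗ π₁.toLinearMap + L x • (ι₂.toLinearMap ∘ₗ y₀ ∘ₗ π₂.toLinearMap)}),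
        ∀ p, ∀ v ∈ H.piece p (n - p), Θ v = ((2 * p - n : ℤ) : ℂ) • v) :
    ∀ 𝔞 : Submodule ℚ (Module.End ℚ V), 𝔞 ≤ H.hodgeLie →
      (∀ X ∈ 𝔞, ∀ Y ∈ 𝔞, X * Y - Y * X ∈ 𝔞) →
      (∃ Θ ∈ Submodule.span ℂ ((fun X : Module.End ℚ V => X.baseChange ℂ) '' (𝔞 : Set (Module.End ℚ V))),
        ∀ p, ∀ x ∈ H.piece p (n - p), Θ x = ((2 * p - n : ℤ) : ℂ) • x) → H.hodgeLie ≤ 𝔞 := by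
  intro 𝔞 h𝔞 hbr hΘ
  rcases hodgeLie_le_or_exists_graph_of_rigid_of_le_span_singleton ι₁ π₁ ι₂ π₂ hπι₁ hπι₂ hsum hrig₁ hy₀ hcorner 𝔞 h𝔞 hbr hΘ with
    h | ⟨L, hL, hgraph⟩
  · exact h
  · exfalso
    refine hNR L hL ?_
    obtain ⟨Θ, hΘmem, hΘ⟩ := hΘ
    refine ⟨Θ, Submodule.span_mono (Set.image_mono fun a ha => ?_) hΘmem, hΘ⟩
    exact ⟨π₁.toLinearMap ∘ₗ a ∘ₗ ι₁.toLinearMap, comp_mem_hodgeLie_of_retract ι₁ π₁ hπι₁ (h𝔞 ha), hgraph a ha⟩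

/-! ## §3 The trace test -/

omit [Module.Finite ℚ V] [HodgeTensorFacts.{u, u}] in
/-- Base change of a rational multiple: `(c • T)_ℂ = c • T_ℂ`. [folklore] -/
private theorem baseChange_ratCast_smul_rk (c : ℚ) (T : Module.End ℚ V) :
    (c • T).baseChange ℂ = (c : ℂ) • T.baseChange ℂ := by
  refine TensorProduct.AlgebraTensorModule.ext fun z v => ?_
  rw [LinearMap.baseChange_tmul, LinearMap.smul_apply, LinearMap.smul_apply, LinearMap.baseChange_tmul,
    TensorProduct.smul_tmul', ← TensorProduct.smul_tmul, Rat.smul_def, smul_eq_mul]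

omit [Module.Finite ℚ V₁] [Module.Finite ℚ V₂] [Module.Finite ℚ V] [HodgeTensorFacts.{u, u}] in
include hπι₁ hπι₂ hsum in
/-- `π₂ ι₁ = 0` for a bicone (`ι₂` is injective and `ι₂ π₂ ι₁ = ι₁ − ι₁ π₁ ι₁ = 0`). [folklore] -/
private theorem proj₂_incl₁_eq_zero_rk : π₂.toLinearMap ∘ₗ ι₁.toLinearMap = 0 := by
  refine LinearMap.ext fun v => ?_
  have h := hsum (ι₁.toLinearMap v)
  rw [hπι₁, add_eq_left] at h
  have h' := congrArg π₂.toLinearMap h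
  rw [hπι₂, map_zero] at h'
  exact h'

include hπι₁ hπι₂ hsum hrig₁ hy₀ hcorner in
/-- **The trace test for `Θ`-rigidity along a summand with `𝔥(H₂) ⊆ ℚ y₀`.**  In the setting of §2 let `ψ₁` polarize `H₁`, let `φ ∈ End_Hdg(H₁)` with
`𝔥(H₁) ∩ End_Hdg(H₁) ⊆ ℚ φ` (centre of rank `≤ 1`), and suppose that for all Hodge operators `Θ₁` of `H₁`, `Θ₂` of `H₂` and every rational `μ`:
`tr(Θ₂ y₀,ℂ)·tr(φ²) ≠ μ·tr(y₀²)·tr(Θ₁ φ_ℂ)`.  Then `H` is `Θ`-rigid.  (A Lie functional `L` kills `[𝔥(H₁), 𝔥(H₁)]`, and `𝔥(H₁) = 𝔷(H₁) ⊕ [𝔥(H₁),𝔥(H₁)]`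
with `𝔷(H₁) ⊆ ℚφ`, so the `ℂ`-linear functional `Z ↦ tr(π₂ Z ι₂ · y₀) tr(φ²) − L(φ) tr(y₀²) tr(π₁ Z ι₁ · φ)` vanishes on the graph of `L` and not at `Θ`.)
[cite: MoonenZarhin1999LowDim, §3 (3.1) and (3.6)] [cite: Deligne1982HodgeCycles, I §3 Prop. 3.6] -/
theorem rigid_of_rigid_of_le_span_singleton_of_trace_ne (ψ₁ : H₁.Polarization) {φ : Module.End ℚ V₁} (hφE : φ ∈ H₁.endAlg)
    (hcen : H₁.hodgeLie ⊓ Subalgebra.toSubmodule H₁.endAlg ≤ ℚ ∙ φ)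
    (hNR : ∀ Θ₁ : Module.End ℂ (ℂ ⊗[ℚ] V₁), (∀ p, ∀ x ∈ H₁.piece p (n - p), Θ₁ x = ((2 * p - n : ℤ) : ℂ) • x) →
      ∀ Θ₂ : Module.End ℂ (ℂ ⊗[ℚ] V₂), (∀ p, ∀ x ∈ H₂.piece p (n - p), Θ₂ x = ((2 * p - n : ℤ) : ℂ) • x) →
      ∀ μ : ℚ, LinearMap.trace ℂ _ (Θ₂ * y₀.baseChange ℂ) * ((LinearMap.trace ℚ V₁ (φ * φ) : ℚ) : ℂ) ≠
        (μ : ℂ) * ((LinearMap.trace ℚ V₂ (y₀ * y₀) : ℚ) : ℂ) * LinearMap.trace ℂ _ (Θ₁ * φ.baseChange ℂ)) :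
    ∀ 𝔞 : Submodule ℚ (Module.End ℚ V), 𝔞 ≤ H.hodgeLie →
      (∀ X ∈ 𝔞, ∀ Y ∈ 𝔞, X * Y - Y * X ∈ 𝔞) →
      (∃ Θ ∈ Submodule.span ℂ ((fun X : Module.End ℚ V => X.baseChange ℂ) '' (𝔞 : Set (Module.End ℚ V))),
        ∀ p, ∀ x ∈ H.piece p (n - p), Θ x = ((2 * p - n : ℤ) : ℂ) • x) → H.hodgeLie ≤ 𝔞 := by
  classical
  refine rigid_of_rigid_of_le_span_singleton_of_forall_not_graph ι₁ π₁ ι₂ π₂ hπι₁ hπι₂ hsum hrig₁ hy₀ hcorner fun L hL => ?_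
  rintro ⟨Θ, hΘmem, hΘ⟩
  -- complexified block maps and the Hodge operators of the factors
  have hπιc₁ : π₁.toLinearMap ∘ₗ ι₁.toLinearMap = LinearMap.id := LinearMap.ext hπι₁
  have hπιc₂ : π₂.toLinearMap ∘ₗ ι₂.toLinearMap = LinearMap.id := LinearMap.ext hπι₂
  have h21 : π₂.toLinearMap ∘ₗ ι₁.toLinearMap = 0 := proj₂_incl₁_eq_zero_rk ι₁ π₁ ι₂ π₂ hπι₁ hπι₂ hsum
  set Θ₁ := π₁.toLinearMap.baseChange ℂ ∘ₗ Θ ∘ₗ ι₁.toLinearMap.baseChange ℂ with hΘ₁def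
  set Θ₂ := π₂.toLinearMap.baseChange ℂ ∘ₗ Θ ∘ₗ ι₂.toLinearMap.baseChange ℂ with hΘ₂def
  have hΘ₁ : ∀ p, ∀ x ∈ H₁.piece p (n - p), Θ₁ x = ((2 * p - n : ℤ) : ℂ) • x := by
    intro p x hx
    have hιx : ι₁.toLinearMap.baseChange ℂ x ∈ H.piece p (n - p) := ι₁.map_piece_le p (n - p) ⟨x, hx, rfl⟩
    rw [hΘ₁def, LinearMap.comp_apply, LinearMap.comp_apply, hΘ p _ hιx, map_smul, ← LinearMap.comp_apply,
      ← LinearMap.baseChange_comp, hπιc₁, LinearMap.baseChange_id, LinearMap.id_apply]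
  have hΘ₂ : ∀ p, ∀ x ∈ H₂.piece p (n - p), Θ₂ x = ((2 * p - n : ℤ) : ℂ) • x := by
    intro p x hx
    have hιx : ι₂.toLinearMap.baseChange ℂ x ∈ H.piece p (n - p) := ι₂.map_piece_le p (n - p) ⟨x, hx, rfl⟩
    rw [hΘ₂def, LinearMap.comp_apply, LinearMap.comp_apply, hΘ p _ hιx, map_smul, ← LinearMap.comp_apply,
      ← LinearMap.baseChange_comp, hπιc₂, LinearMap.baseChange_id, LinearMap.id_apply]
  -- the test functional
  let blk₁ : Module.End ℂ (ℂ ⊗[ℚ] V) →ₗ[ℂ] Module.End ℂ (ℂ ⊗[ℚ] V₁) :=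
    (LinearMap.llcomp ℂ _ _ _ (π₁.toLinearMap.baseChange ℂ)).comp (LinearMap.lcomp ℂ _ (ι₁.toLinearMap.baseChange ℂ))
  let blk₂ : Module.End ℂ (ℂ ⊗[ℚ] V) →ₗ[ℂ] Module.End ℂ (ℂ ⊗[ℚ] V₂) :=
    (LinearMap.llcomp ℂ _ _ _ (π₂.toLinearMap.baseChange ℂ)).comp (LinearMap.lcomp ℂ _ (ι₂.toLinearMap.baseChange ℂ))
  have hblk₁ : ∀ Z, blk₁ Z = π₁.toLinearMap.baseChange ℂ ∘ₗ Z ∘ₗ ι₁.toLinearMap.baseChange ℂ := fun Z => rfl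
  have hblk₂ : ∀ Z, blk₂ Z = π₂.toLinearMap.baseChange ℂ ∘ₗ Z ∘ₗ ι₂.toLinearMap.baseChange ℂ := fun Z => rfl
  let t₁ : Module.End ℂ (ℂ ⊗[ℚ] V) →ₗ[ℂ] ℂ := LinearMap.trace ℂ _ ∘ₗ LinearMap.mulRight ℂ (φ.baseChange ℂ) ∘ₗ blk₁
  let t₂ : Module.End ℂ (ℂ ⊗[ℚ] V) →ₗ[ℂ] ℂ := LinearMap.trace ℂ _ ∘ₗ LinearMap.mulRight ℂ (y₀.baseChange ℂ) ∘ₗ blk₂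
  have ht₁ : ∀ Z, t₁ Z = LinearMap.trace ℂ _ ((π₁.toLinearMap.baseChange ℂ ∘ₗ Z ∘ₗ ι₁.toLinearMap.baseChange ℂ) * φ.baseChange ℂ) :=
    fun Z => rfl
  have ht₂ : ∀ Z, t₂ Z = LinearMap.trace ℂ _ ((π₂.toLinearMap.baseChange ℂ ∘ₗ Z ∘ₗ ι₂.toLinearMap.baseChange ℂ) * y₀.baseChange ℂ) :=
    fun Z => rfl
  set μ : ℚ := L φ with hμ
  let F : Module.End ℂ (ℂ ⊗[ℚ] V) →ₗ[ℂ] ℂ :=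
    ((LinearMap.trace ℚ V₁ (φ * φ) : ℚ) : ℂ) • t₂ - ((μ : ℂ) * ((LinearMap.trace ℚ V₂ (y₀ * y₀) : ℚ) : ℂ)) • t₁
  have hF : ∀ Z, F Z = ((LinearMap.trace ℚ V₁ (φ * φ) : ℚ) : ℂ) * t₂ Z - ((μ : ℂ) * ((LinearMap.trace ℚ V₂ (y₀ * y₀) : ℚ) : ℂ)) * t₁ Z :=
    fun Z => rfl
  -- `L` and `tr(· φ)` on `𝔥(H₁) = 𝔷 ⊕ [𝔥, 𝔥]`
  have hLd : ∀ d ∈ Submodule.span ℚ {B | ∃ X ∈ H₁.hodgeLie, ∃ Y ∈ H₁.hodgeLie, X * Y - Y * X = B}, L d = 0 := by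
    intro d hd
    have hle : Submodule.span ℚ {B | ∃ X ∈ H₁.hodgeLie, ∃ Y ∈ H₁.hodgeLie, X * Y - Y * X = B} ≤ LinearMap.ker L :=
      Submodule.span_le.2 (by rintro _ ⟨X, hX, Y, hY, rfl⟩; exact hL X hX Y hY)
    exact hle hd
  have htrd : ∀ d ∈ Submodule.span ℚ {B | ∃ X ∈ H₁.hodgeLie, ∃ Y ∈ H₁.hodgeLie, X * Y - Y * X = B}, LinearMap.trace ℚ V₁ (d * φ) = 0 := by
    intro d hd
    have hle : Submodule.span ℚ {B | ∃ X ∈ H₁.hodgeLie, ∃ Y ∈ H₁.hodgeLie, X * Y - Y * X = B} ≤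
        LinearMap.ker (LinearMap.trace ℚ V₁ ∘ₗ LinearMap.mulRight ℚ φ) :=
      Submodule.span_le.2 (by
        rintro _ ⟨X, hX, Y, hY, rfl⟩
        have hYφ : Y * φ = φ * Y := commute_of_mem_hodgeLie H₁ hY ⟨φ, hφE⟩
        change LinearMap.trace ℚ V₁ ((X * Y - Y * X) * φ) = 0
        rw [sub_mul, map_sub, mul_assoc, mul_assoc, hYφ, ← mul_assoc X φ Y, LinearMap.trace_mul_comm ℚ (X * φ) Y, sub_self])
    exact hle hd
  have hdec : ∀ x ∈ H₁.hodgeLie, ∃ q : ℚ, L x = q * μ ∧ LinearMap.trace ℚ V₁ (x * φ) = q * LinearMap.trace ℚ V₁ (φ * φ) := by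
    intro x hx
    rw [← AnyWeight.hodgeLie_center_sup_derived_eq H₁ ψ₁] at hx
    obtain ⟨z, hz, d, hd, rfl⟩ := Submodule.mem_sup.1 hx
    obtain ⟨q, hq⟩ := Submodule.mem_span_singleton.1 (hcen hz)
    refine ⟨q, ?_, ?_⟩
    · rw [map_add, hLd d hd, add_zero, ← hq, map_smul, smul_eq_mul, hμ]
    · rw [add_mul, map_add, htrd d hd, add_zero, ← hq, smul_mul_assoc, map_smul, smul_eq_mul]
  -- `F` vanishes on the graph generators
  have hgen : ∀ x ∈ H₁.hodgeLie,
      F ((ι₁.toLinearMap ∘ₗ x ∘ₗ π₁.toLinearMap + L x • (ι₂.toLinearMap ∘ₗ y₀ ∘ₗ π₂.toLinearMap)).baseChange ℂ) = 0 := by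
    intro x hx
    obtain ⟨q, hLx, htrx⟩ := hdec x hx
    have hb₁ : π₁.toLinearMap.baseChange ℂ ∘ₗ (ι₁.toLinearMap ∘ₗ x ∘ₗ π₁.toLinearMap + L x • (ι₂.toLinearMap ∘ₗ y₀ ∘ₗ π₂.toLinearMap)).baseChange ℂ ∘ₗ
        ι₁.toLinearMap.baseChange ℂ = x.baseChange ℂ := by
      rw [← LinearMap.baseChange_comp, ← LinearMap.baseChange_comp]
      congr 1
      rw [LinearMap.add_comp, LinearMap.comp_add, LinearMap.smul_comp, LinearMap.comp_smul]
      have e1 : π₁.toLinearMap ∘ₗ (ι₁.toLinearMap ∘ₗ x ∘ₗ π₁.toLinearMap) ∘ₗ ι₁.toLinearMap = x :=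
        LinearMap.ext fun v => by simp only [LinearMap.comp_apply, hπι₁]
      have e2 : π₁.toLinearMap ∘ₗ (ι₂.toLinearMap ∘ₗ y₀ ∘ₗ π₂.toLinearMap) ∘ₗ ι₁.toLinearMap = 0 :=
        LinearMap.ext fun v => by
          have h := LinearMap.congr_fun h21 v
          simp only [LinearMap.comp_apply, LinearMap.zero_apply] at h
          simp only [LinearMap.comp_apply, h, map_zero, LinearMap.zero_apply]
      rw [e1, e2, smul_zero, add_zero]
    have hb₂ : π₂.toLinearMap.baseChange ℂ ∘ₗ (ι₁.toLinearMap ∘ₗ x ∘ₗ π₁.toLinearMap + L x • (ι₂.toLinearMap ∘ₗ y₀ ∘ₗ π₂.toLinearMap)).baseChange ℂ ∘ₗ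
        ι₂.toLinearMap.baseChange ℂ = ((L x : ℚ) : ℂ) • y₀.baseChange ℂ := by
      rw [← LinearMap.baseChange_comp, ← LinearMap.baseChange_comp, ← baseChange_ratCast_smul_rk]
      congr 1
      rw [LinearMap.add_comp, LinearMap.comp_add, LinearMap.smul_comp, LinearMap.comp_smul]
      have e1 : π₂.toLinearMap ∘ₗ (ι₁.toLinearMap ∘ₗ x ∘ₗ π₁.toLinearMap) ∘ₗ ι₂.toLinearMap = 0 :=
        LinearMap.ext fun v => by
          have h := LinearMap.congr_fun h21 (x (π₁.toLinearMap (ι₂.toLinearMap v)))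
          simp only [LinearMap.comp_apply, LinearMap.zero_apply] at h
          simp only [LinearMap.comp_apply, h, LinearMap.zero_apply]
      have e2 : π₂.toLinearMap ∘ₗ (ι₂.toLinearMap ∘ₗ y₀ ∘ₗ π₂.toLinearMap) ∘ₗ ι₂.toLinearMap = y₀ :=
        LinearMap.ext fun v => by simp only [LinearMap.comp_apply, hπι₂]
      rw [e1, e2, zero_add]
    rw [hF, ht₁, ht₂, hb₁, hb₂, smul_mul_assoc, map_smul, ← LinearMap.baseChange_mul, ← LinearMap.baseChange_mul,
      LinearMap.trace_baseChange, LinearMap.trace_baseChange, htrx, hLx, smul_eq_mul]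
    simp only [eq_ratCast, Rat.cast_mul]
    ring
  -- hence on the complex span of the graph, in particular at `Θ`
  have hFΘ : F Θ = 0 := by
    have hle : Submodule.span ℂ ((fun X : Module.End ℚ V => X.baseChange ℂ) ''
        {Z | ∃ x ∈ H₁.hodgeLie, Z = ι₁.toLinearMap ∘ₗ x ∘ₗ π₁.toLinearMap + L x • (ι₂.toLinearMap ∘ₗ y₀ ∘ₗ π₂.toLinearMap)}) ≤
        LinearMap.ker F :=
      Submodule.span_le.2 (by
        rintro _ ⟨Z, ⟨x, hx, rfl⟩, rfl⟩
        exact hgen x hx)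
    exact hle hΘmem
  -- but `F Θ = tr(Θ₂ y₀) tr(φ²) − μ tr(y₀²) tr(Θ₁ φ) ≠ 0`
  refine hNR Θ₁ hΘ₁ Θ₂ hΘ₂ μ ?_
  have h := hFΘ
  rw [hF, ht₁, ht₂, ← hΘ₁def, ← hΘ₂def] at h
  have h' : LinearMap.trace ℂ _ (Θ₂ * y₀.baseChange ℂ) * ((LinearMap.trace ℚ V₁ (φ * φ) : ℚ) : ℂ) =
      (μ : ℂ) * ((LinearMap.trace ℚ V₂ (y₀ * y₀) : ℚ) : ℂ) * LinearMap.trace ℂ _ (Θ₁ * φ.baseChange ℂ) := by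
    have := sub_eq_zero.1 h
    rw [mul_comm] at this
    rw [this]
  exact h'

end HodgeStructure

end Literature.AlgebraicGeometry.Motives

end
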